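import Summits.ResolutionOfSingularities.ResolutionOfSingularities.Theses.WeightedInvariant
import Summits.ResolutionOfSingularities.ResolutionOfSingularities.Theorems.WeightedInvariantWeightedThesisHypersurfaceDatum
import Literature.AlgebraicGeometry.Resolution.MarkedIdeals
import HarnessLib

/-!
# LINE `transversal-dimension-ladder` under the crux `GlobalizeLocalDrop` (stmt-ResolutionOfSingularities-14763)

Forward generator G4 (ladder-down).  Ladder variable: the TRANSVERSAL DIMENSION `d` = height of
the point of the smooth ambient scheme at which the (orbit-sliced) weighted cobordant blow-up game
is played — Abramovich–Quek–Schober 2025 prove transversal dimension `2` (curves in regular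
surfaces, any field) with `ι = ord`.

* `SlicedLocalDrop p d := ∃ Γ ι, UscClause p ι ∧ ComapClause p ι ∧ SlicedDropClause p d ι` — one
  well-ordered invariant `ι(f : Y → Spec k, X, y)`, UPPER SEMICONTINUOUS on smooth `Y` and
  FUNCTORIAL FOR SMOOTH `k`-MORPHISMS (the two axioms (usc), (i) of a `WeightedResolutionDatum`,
  verbatim shapes), which at every singular point `y` of height `2 … d` of an integral hypersurface
  `X ⊆ Y` (`Y` smooth separated quasi-compact over a perfect field of characteristic `p`) admits a
  regular weighted centre through `y` on an affine neighbourhood such that `ι` drops at every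
  HOMOGENEOUS (`𝔾ₘ`-orbit-generic) singular point of height `2 … d` of the strict transform on the
  cobordant blow-up `B₊` lying over `y`.
* `TransversalRung d := ∀ p prime, SlicedLocalDrop p d` — FLOOR `d = 2`: `transversalRung_two`
  (AQS 2025 + usc and smooth-invariance of the order, three named facts); NEXT RUNG `d = 3`.
* Why the clauses: without (usc)+(i) the existential-`ι` statement follows classically (game
  rank of the weights-`1` game) wherever embedded resolution one dimension down is known, e.g.
  `d = 3` from Cossart–Jannsen–Saito 2009 — so the clauses are exactly what makes `d = 3` open and
  what the datum needs (0571 census, TRANSFER T2–T7).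
* Skeleton (this file, second half): `stub_rungThree → stub_climb → stub_globalize → stub_extend →
  GlobalizeLocalDrop` (`GlobalizeLocalDrop_of`, kernel-checked; sorries only in the four stubs).
-/

noncomputable section

open CategoryTheory AlgebraicGeometry TopologicalSpace
open Literature.AlgebraicGeometry.Resolution

universe u

namespace Summit.ResolutionOfSingularities.ResolutionOfSingularities.Cruxes.GlobalizeLocalDrop.TransversalDimensionLadder

/-- `X ⊆ Y` (an ideal sheaf) is **singular at** `y ∈ Y`: some point of `X.subscheme` over `y`
has a non-regular local ring (negation of the right-hand side of the datum axiom `(ii)`). -/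
def SingularAt {Y : Scheme.{u}} (X : Y.IdealSheafData) (y : Y) : Prop :=
  ∃ x : X.subscheme, X.subschemeι x = y ∧ ¬ IsRegularLocalRing (X.subscheme.presheaf.stalk x)

/-- A point of the full cobordant blow-up `B = Spec A[t⁻¹, Iₙ tⁿ]` is **homogeneous**: its prime
ideal contains, together with any element, each homogeneous component of that element (w.r.t.
the `ℤ`-grading of `A[t, t⁻¹]`).  These are exactly the `𝔾ₘ`-fixed points of `|B|`, i.e. the
generic points of the `𝔾ₘ`-stable irreducible closed subsets (orbit closures): the "closed
orbits `𝒬`" at whose generic points Abramovich–Quek–Schober localise. -/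
def IsHomogeneousPt {A : Type u} [CommRing A] {I : ℕ → Ideal A}
    (b : affineCobordantBlowup I) : Prop :=
  ∀ x ∈ (b : PrimeSpectrum (extReesAlgebra I)).asIdeal, ∀ n : ℤ,
    ∀ hx : LaurentPolynomial.C ((x : LaurentPolynomial A).coeff n) * LaurentPolynomial.T n ∈ extReesAlgebra I,
      (⟨_, hx⟩ : extReesAlgebra I) ∈ (b : PrimeSpectrum (extReesAlgebra I)).asIdeal

/-- The DROP clause of `SlicedLocalDrop p d` for a given invariant `ι`: for every perfect field
`k` of characteristic `p`, every smooth separated quasi-compact `f : Y → Spec k`, every integral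
locally principal `X ⊆ Y` and every point `y ∈ Y` of height between `2` and `d` at which `X` is
singular, there are an open `V ∋ y`, a Rees algebra `R` on `V` and an affine chart `U ∋ y` of `V`
on which `R` is the regular weighted centre `(u₁^{1/w₁}, …, uₘ^{1/wₘ})`, `m ≥ 1`, all `uᵢ`
vanishing at `y`, such that at every HOMOGENEOUS point `b` of the cobordant blow-up `B₊(U)` lying
over `y`, of height between `2` and `d`, at which the strict transform `X'` is singular,
`ι(B₊(U), X', b) < ι(Y, X, y)`. -/
def SlicedDropClause (p d : ℕ) {Γ : Type} [LT Γ]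
    (ι : ∀ ⦃k : Type⦄ [Field k] ⦃Y : Scheme.{0}⦄, (Y ⟶ Spec (.of k)) → Y.IdealSheafData → Y → Γ) :
    Prop :=
  ∀ ⦃k : Type⦄ [Field k] [CharP k p] [PerfectField k] ⦃Y : Scheme.{0}⦄
    (f : Y ⟶ Spec (.of k)) [Smooth f] [IsSeparated f] [QuasiCompact f]
    (X : Y.IdealSheafData), IsLocallyPrincipal X → IsIntegral X.subscheme →
    ∀ y : Y, ((2 : ℕ) : WithBot ℕ∞) ≤ ringKrullDim (Y.presheaf.stalk y) →
      ringKrullDim (Y.presheaf.stalk y) ≤ (d : WithBot ℕ∞) →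
      SingularAt X y →
      ∃ (V : Y.Opens) (hyV : y ∈ V) (R : ReesAlgebraData (V : Scheme.{0}))
        (U : (V : Scheme.{0}).affineOpens)
        (hyU : (⟨y, hyV⟩ : (V : Scheme.{0})) ∈ (U : (V : Scheme.{0}).Opens))
        (m : ℕ) (_ : 0 < m) (u : Fin m → Γ((V : Scheme.{0}), U)) (w : Fin m → ℕ),
        R.IsWeightedChart U u w ∧
        (∀ i, ((V : Scheme.{0}).presheaf.germ (U : (V : Scheme.{0}).Opens) ⟨y, hyV⟩ hyU).hom (u i) ∈
          IsLocalRing.maximalIdeal ((V : Scheme.{0}).presheaf.stalk ⟨y, hyV⟩)) ∧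
        ∀ b : R.cobordantPlus U,
          R.cobordantPlusι U b = ⟨y, hyV⟩ →
          IsHomogeneousPt ((affineCobordantBlowup.plusOpens (R.chartIdeals U)).ι b) →
          ((2 : ℕ) : WithBot ℕ∞) ≤ ringKrullDim ((R.cobordantPlus U).presheaf.stalk b) →
          ringKrullDim ((R.cobordantPlus U).presheaf.stalk b) ≤ (d : WithBot ℕ∞) →
          SingularAt (R.cobordantStrictTransform U (X.comap V.ι)) b →
            ι (R.cobordantPlusι U ≫ V.ι ≫ f) (R.cobordantStrictTransform U (X.comap V.ι)) b
              < ι f X y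

/-- The UPPER-SEMICONTINUITY clause for an invariant `ι` (the datum's axiom (usc), verbatim
shape of `WeightedResolutionDatum.isClosed_superlevel`): superlevel sets are closed. -/
def UscClause (p : ℕ) {Γ : Type} [LE Γ]
    (ι : ∀ ⦃k : Type⦄ [Field k] ⦃Y : Scheme.{0}⦄, (Y ⟶ Spec (.of k)) → Y.IdealSheafData → Y → Γ) :
    Prop :=
  ∀ ⦃k : Type⦄ [Field k] [CharP k p] [PerfectField k] ⦃Y : Scheme.{0}⦄
    (f : Y ⟶ Spec (.of k)) [Smooth f] [IsSeparated f] [QuasiCompact f] (X : Y.IdealSheafData)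
    (γ : Γ), IsClosed {y : Y | γ ≤ ι f X y}

/-- The SMOOTH-FUNCTORIALITY clause for an invariant `ι` (the datum's axiom (i) for smooth
`k`-morphisms, verbatim shape of `WeightedResolutionDatum.inv_comap`). -/
def ComapClause (p : ℕ) {Γ : Type}
    (ι : ∀ ⦃k : Type⦄ [Field k] ⦃Y : Scheme.{0}⦄, (Y ⟶ Spec (.of k)) → Y.IdealSheafData → Y → Γ) :
    Prop :=
  ∀ ⦃k : Type⦄ [Field k] [CharP k p] [PerfectField k] ⦃Y Y₁ : Scheme.{0}⦄
    (f : Y ⟶ Spec (.of k)) [Smooth f] [IsSeparated f] [QuasiCompact f]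
    (f₁ : Y₁ ⟶ Spec (.of k)) [Smooth f₁] [IsSeparated f₁] [QuasiCompact f₁]
    (g : Y₁ ⟶ Y) [Smooth g], g ≫ f = f₁ →
    ∀ (X : Y.IdealSheafData) (y₁ : Y₁), ι f₁ (X.comap g) y₁ = ι f X (g y₁)

/-- **Sliced local weighted drop in transversal dimension `≤ d` (characteristic `p`).**
There are a well-ordered value set `Γ` and an invariant `ι` of (ambient `k`-scheme, ideal sheaf,
point) which is UPPER SEMICONTINUOUS on every smooth `Y` (`UscClause`), FUNCTORIAL FOR SMOOTH
`k`-MORPHISMS (`ComapClause`) — the two axioms (usc), (i) of a weighted resolution datum that make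
an invariant intrinsic — and which DROPS in the sliced weighted game up to transversal dimension
`d` (`SlicedDropClause`).  Without (usc)+(i) the statement would follow classically in every `d`
for which embedded resolution of `(d-1)`-folds is known (game rank of the weights-`1` game, e.g.
`d = 3` from Cossart–Jannsen–Saito 2009); with them it is the local, sliced shadow of the datum. -/
@[conjecture]
def SlicedLocalDrop (p d : ℕ) : Prop :=
  ∃ (Γ : Type) (_ : LinearOrder Γ) (_ : WellFoundedLT Γ)
    (ι : ∀ ⦃k : Type⦄ [Field k] ⦃Y : Scheme.{0}⦄, (Y ⟶ Spec (.of k)) → Y.IdealSheafData → Y → Γ),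
    UscClause p ι ∧ ComapClause p ι ∧ SlicedDropClause p d ι

/-- **Rung `d` of the transversal-dimension ladder**: sliced local weighted drop in transversal
dimension `≤ d` in every positive characteristic. -/
@[conjecture]
def TransversalRung (d : ℕ) : Prop :=
  ∀ p : ℕ, p.Prime → SlicedLocalDrop p d


/-! ## The floor: Abramovich–Quek–Schober 2025 (transversal dimension two), as a named fact -/

/-- **Abramovich–Quek–Schober 2025, order drop under the canonical weighted blow-up in
transversal dimension two** (the printed Theorems 1.1 (1),(3) / 1.3 (1),(3), specialised to a
smooth ambient scheme over a field and written on an affine neighbourhood of the point, as in the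
proof of Thm. 1.1, which passes "to the localization at the generic point of `𝒬`"): for a
hypersurface `X` (integral, locally principal) in `Y` smooth over a field `k`, and a point `y ∈ Y`
of height `2` at which `X` is singular, there is a regular weighted centre
`J̄ = (u₁^{1/w₁}, u₂^{1/w₂})` through `y` on an affine neighbourhood (`J = (x₁^{a₁}, x₂^{a₂})`,
`a₁ = ord_y X`, `a₂ = a₁ δ`, `δ` the vertex of Hironaka's characteristic polyhedron) such that on
the cobordant blow-up `B₊` the strict transform has ORDER `< a₁ = ord_y X` at every point over `y`.
Any field, any characteristic. A NAMED FACT (hypothesis), to be promoted to `Literature/`.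
[cite: arXiv:2507.01232, Thm. 1.1 (1),(3) and Thm. 1.3 (1),(3)] -/
def AbramovichQuekSchober2025 : Prop :=
  ∀ ⦃k : Type⦄ [Field k] ⦃Y : Scheme.{0}⦄
    (f : Y ⟶ Spec (.of k)) [Smooth f] [IsSeparated f] [QuasiCompact f]
    (X : Y.IdealSheafData), IsLocallyPrincipal X → IsIntegral X.subscheme →
    ∀ y : Y, ringKrullDim (Y.presheaf.stalk y) = ((2 : ℕ) : WithBot ℕ∞) → SingularAt X y →
      ∃ (V : Y.Opens) (hyV : y ∈ V) (R : ReesAlgebraData (V : Scheme.{0}))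
        (U : (V : Scheme.{0}).affineOpens)
        (hyU : (⟨y, hyV⟩ : (V : Scheme.{0})) ∈ (U : (V : Scheme.{0}).Opens))
        (u : Fin 2 → Γ((V : Scheme.{0}), U)) (w : Fin 2 → ℕ),
        R.IsWeightedChart U u w ∧
        (∀ i, ((V : Scheme.{0}).presheaf.germ (U : (V : Scheme.{0}).Opens) ⟨y, hyV⟩ hyU).hom (u i) ∈
          IsLocalRing.maximalIdeal ((V : Scheme.{0}).presheaf.stalk ⟨y, hyV⟩)) ∧
        ∀ b : R.cobordantPlus U, R.cobordantPlusι U b = ⟨y, hyV⟩ →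
          idealOrder (R.cobordantStrictTransform U (X.comap V.ι)) b < idealOrder X y

/-- **Upper semicontinuity of the order of an ideal sheaf on a smooth scheme over a field**
(Hironaka; Cossart–Piltant 2008, proof of Prop. 4.2; in the tree for integral Noetherian regular
excellent schemes as `isClosed_setOf_le_idealOrder`): every superlevel set `{y | γ ≤ ord_y X}` is
closed. A NAMED FACT (hypothesis). [cite: CossartPiltant2008, Prop. 4.2 (proof)] -/
def OrderUpperSemicontinuous : Prop :=
  ∀ ⦃k : Type⦄ [Field k] ⦃Y : Scheme.{0}⦄
    (f : Y ⟶ Spec (.of k)) [Smooth f] [IsSeparated f] [QuasiCompact f] (X : Y.IdealSheafData)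
    (γ : ℕ∞), IsClosed {y : Y | γ ≤ idealOrder X y}

/-- **The order of an ideal sheaf is invariant under smooth morphisms** (flat local homomorphisms
with regular closed fibre preserve `𝔪`-adic orders; in the tree: `idealOrder_comap_of_etale`,
`mem_pow_maximalIdeal_iff_of_isRegularLocalRing_fiber`): `ord_{y₁}(g⁻¹X) = ord_{g y₁}(X)` for a
smooth `k`-morphism `g : Y₁ → Y`. A NAMED FACT (hypothesis). [cite: Kollar2007, 3.34.1 (p. 131)] -/
def OrderSmoothInvariant : Prop :=
  ∀ ⦃k : Type⦄ [Field k] ⦃Y Y₁ : Scheme.{0}⦄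
    (f : Y ⟶ Spec (.of k)) [Smooth f] [IsSeparated f] [QuasiCompact f]
    (f₁ : Y₁ ⟶ Spec (.of k)) [Smooth f₁] [IsSeparated f₁] [QuasiCompact f₁]
    (g : Y₁ ⟶ Y) [Smooth g], g ≫ f = f₁ →
    ∀ (X : Y.IdealSheafData) (y₁ : Y₁), idealOrder (X.comap g) y₁ = idealOrder X (g y₁)

/-- **Floor of the ladder (`d = 2`) from AQS 2025**: with `Γ := ℕ∞` and `ι := ord` (the order of
the hypersurface at the point; usc and smooth-functorial by the two classical order facts), the
sliced drop in transversal dimension `≤ 2` is the AQS theorem: positions have height exactly `2`,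
the centre has two parameters, and the order drops at every point of `B₊` over `y` — in particular
at the homogeneous singular ones. [folklore] -/
theorem transversalRung_two (h : AbramovichQuekSchober2025) (husc : OrderUpperSemicontinuous)
    (hcomap : OrderSmoothInvariant) : TransversalRung 2 := by
  intro p _
  refine ⟨ℕ∞, inferInstance, inferInstance, fun k _ Y f X y => idealOrder X y, ?_, ?_, ?_⟩
  · intro k _ _ _ Y f _ _ _ X γ
    exact husc f X γ
  · intro k _ _ _ Y Y₁ f _ _ _ f₁ _ _ _ g _ hg X y₁
    exact hcomap f f₁ g hg X y₁
  · intro k _ _ _ Y f _ _ _ X hX hXi y h2 hd hs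
    obtain ⟨V, hyV, R, U, hyU, u, w, hc, hm, hdrop⟩ := h f X hX hXi y (le_antisymm hd h2) hs
    exact ⟨V, hyV, R, U, hyU, 2, two_pos, u, w, hc, hm, fun b hb _ _ _ _ => hdrop b hb⟩

/-! ## Monotonicity in the transversal dimension and the limit over `d` -/

/-- Rungs are monotone: positions and successor points of height `≤ d` are among those of
height `≤ d'` for `d ≤ d'`. [folklore] -/
theorem slicedLocalDrop_mono {p d d' : ℕ} (hdd : d ≤ d') (h : SlicedLocalDrop p d') :
    SlicedLocalDrop p d := by
  obtain ⟨Γ, _, _, ι, husc, hcomap, H⟩ := h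
  refine ⟨Γ, ‹_›, ‹_›, ι, husc, hcomap, ?_⟩
  intro k _ _ _ Y f _ _ _ X hX hXi y h2 hd hs
  have hcast : (d : WithBot ℕ∞) ≤ (d' : WithBot ℕ∞) := by exact_mod_cast hdd
  obtain ⟨V, hyV, R, U, hyU, m, hm, u, w, hc, hmx, hdrop⟩ := H f X hX hXi y h2 (hd.trans hcast) hs
  exact ⟨V, hyV, R, U, hyU, m, hm, u, w, hc, hmx,
    fun b hb hh h2b hdb hsb => hdrop b hb hh h2b (hdb.trans hcast) hsb⟩

/-- Monotonicity of the rungs in `d`. [folklore] -/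
theorem transversalRung_mono {d d' : ℕ} (hdd : d ≤ d') (h : TransversalRung d') :
    TransversalRung d :=
  fun p hp => slicedLocalDrop_mono hdd (h p hp)

/-- Rung `3` and the climbing step give every rung. [folklore] -/
theorem transversalRung_all (h3 : TransversalRung 3)
    (hclimb : ∀ d : ℕ, 3 ≤ d → TransversalRung d → TransversalRung (d + 1)) (d : ℕ) :
    TransversalRung d := by
  rcases le_or_gt d 3 with hd | hd
  · exact transversalRung_mono hd h3
  · exact Nat.le_induction h3 (fun n hn ih => hclimb n hn ih) d hd.le


/-! ## LINE `transversal-dimension-ladder` — skeleton for crux `GlobalizeLocalDrop` (stmt-…-14763)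

Four registered stubs and the kernel-checked composition `GlobalizeLocalDrop_of`.  The ladder:
`stub_rungThree` (NEXT RUNG, transversal dimension 3 = surfaces in smooth threefolds, sliced) →
`stub_climb` (induction on the transversal dimension, the AQS architecture) → `stub_globalize`
(positional sliced drop in all transversal dimensions ⇒ a hypersurfaces-only weighted resolution
datum: usc + smooth-functorial invariant, functorial centres — door (α) of the 0571 census) →
`stub_extend` (hypersurface datum ⇒ datum for all ideals = `WeightedConstruction`, the census'
`Sub_E`) → `GlobalizeLocalDrop` (whose antecedent `LocalWeightedDrop` is idle:
`globalizeLocalDrop_iff_not_or`). -/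

/-! ### Name-keyed statements of the stubs (the hypotheses of `GlobalizeLocalDrop_of`) -/
namespace __Registered

/-- Statement of `stub_rungThree`: the next rung, transversal dimension `3`. -/
abbrev stub_rungThree : Prop := TransversalRung 3

/-- Statement of `stub_climb`: induction on the transversal dimension from `3` upwards. -/
abbrev stub_climb : Prop := ∀ d : ℕ, 3 ≤ d → TransversalRung d → TransversalRung (d + 1)

/-- Statement of `stub_globalize`: sliced positional drop in every transversal dimension gives a
hypersurfaces-only weighted resolution datum in every characteristic. -/
abbrev stub_globalize : Prop :=
  (∀ d : ℕ, TransversalRung d) → ∀ p : ℕ, p.Prime → Nonempty (Theorems.HypersurfaceResolutionDatum p)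

/-- Statement of `stub_extend`: a hypersurfaces-only datum in every characteristic gives the full
datum (`WeightedConstruction`). -/
abbrev stub_extend : Prop :=
  (∀ p : ℕ, p.Prime → Nonempty (Theorems.HypersurfaceResolutionDatum p)) →
    Theses.WeightedInvariant.WeightedConstruction

end __Registered

/-- **stub_rungThree — THE NEXT RUNG (load-bearing).** Sliced local weighted drop in transversal
dimension `≤ 3`, every characteristic `p`: ONE well-ordered invariant `ι`, upper semicontinuous on
every smooth `k`-scheme and functorial for smooth `k`-morphisms (the datum's axioms (usc), (i)),
such that at a singular point `y` of height `≤ 3` of an integral hypersurface in a smooth scheme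
over a perfect field there is a regular weighted centre through `y` after whose cobordant blow-up
`ι` has dropped at every homogeneous singular point of height `≤ 3` over `y`.  Why plausibly true:
it is the sliced, local shadow of the conjectured datum (on path: a `WeightedResolutionDatum p`
gives it with `ι := inv`, the centre restricted to a neighbourhood where `inv ≤ inv y`), and the
`d = 2` case holds with `ι := ord` (AQS 2025, `transversalRung_two`).  Why it might fail: at
`z² = x³y³` no weighted centre lowers the ORDER at the orbit-generic points, so `ι` must refine the
order by a secondary term that is usc AND smooth-functorial AND drops in one move — the known
surface invariants are either history-dependent (Cossart–Jannsen–Saito use the boundary) or not usc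
at non-closed points (Hauser–Wagner's "generic going up" of the residual order), and for `p = 2`
Hironaka's directrix theorem already fails in local dimension `3 = 2p - 1` over imperfect residue
fields (Cossart–Piltant).  Without (usc)+(i) the statement would follow from CJS 2009 by game rank —
the clauses are what make it a rung.  Size: L–XL (research).
[cite: arXiv:2507.01232, Thm. 1.1; arXiv:0905.2191, Thm. 2; arXiv:1403.6789, §1 (7)] -/
theorem stub_rungThree : __Registered.stub_rungThree := by
  sorry

/-- **stub_climb — induction on the transversal dimension.** For `d ≥ 3`, the sliced drop in
transversal dimension `≤ d` implies it in dimension `≤ d + 1`.  This is the shape of the AQS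
argument ("we deduce an inductive argument, despite the fact that higher dimensional tangent
spaces arise, by taking torus actions and equivariant centers into account"): successors are
measured only at orbit-generic points, whose height does not exceed that of the starting point.
Why it might fail: in transversal dimension `d + 1` the first centre must be chosen at a point of
height `d + 1`, where rung `d` says nothing; the induction needs a descent-in-dimension device
(maximal contact fails in char `p`: Narasimhan).  Size: XL (research; char-`p` induction on
dimension is the summit's core difficulty, here confined to hypersurfaces and sliced positions).
[cite: arXiv:2507.01232, §1] -/
theorem stub_climb : __Registered.stub_climb := by
  sorry

/-- **stub_globalize — from sliced positional drop to a hypersurface datum.** Assuming the sliced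
drop in every transversal dimension, build `Theorems.HypersurfaceResolutionDatum p`: ONE
well-ordered `Γ`, an upper-semicontinuous invariant functorial for smooth morphisms and perfect
field extensions, vanishing exactly at regular points, and functorial regular weighted centres on
its maximum locus whose cobordant blow-ups lower the maximum.  Why plausibly true: the rungs
already deliver the intrinsic half (usc + smooth functoriality of `ι`); what remains is
Włodarczyk's functorial passage local → global (a CANONICAL centre on the maximum locus glues and
is smooth-functorial), the 0571 census' transfer steps T2–T7, cf.
`Theorems.WeightedThesis.weightedThesis_iff_hypersurfaces` for why hypersurfaces suffice
downstream.  Why it might fail: the rungs give one `(Γ, ι)` per `(p, d)`, not one for all `d`, and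
say nothing about functoriality of the CENTRE or base change of the ground field; a sliced
existential centre need not be canonical, and non-canonical local centres do not glue.  Size: XL.
[cite: Wlodarczyk2022, Thm. 4.3.1; AbramovichTemkinWlodarczyk2024, Thm. 1.1.1] -/
theorem stub_globalize : __Registered.stub_globalize := by
  sorry

/-- **stub_extend — hypersurfaces to all ideals** (`Sub_E` of the 0571 STRATEGY-CENSUS): a weighted
resolution datum for integral hypersurfaces in every characteristic yields one for all ideal
sheaves.  Why plausibly true: in characteristic zero the invariant of an ideal is read off
hypersurfaces of maximal contact / generic members; `weightedThesis_iff_hypersurfaces` shows the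
RESOLUTION consequence already only needs hypersurfaces.  Why it might fail: in char `p` there is
no maximal contact, and the datum's axiom `(iv)` for a non-principal ideal is not implied by `(iv)`
for its generic hypersurface.  Size: L–XL. [cite: Kollar2007, §3.13; Wlodarczyk2022, §4] -/
theorem stub_extend : __Registered.stub_extend := by
  sorry

/-! ### The composition (kernel-checked, no `sorry` of its own) -/

/-- **Skeleton theorem.** Rung `3` + climb give every rung (`transversalRung_all`); globalize gives
the hypersurface datum; extend gives `WeightedConstruction`; `GlobalizeLocalDrop` is
`LocalWeightedDrop → WeightedConstruction`, so its antecedent is discarded. [folklore] -/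
theorem GlobalizeLocalDrop_of :
    __Registered.stub_rungThree → __Registered.stub_climb → __Registered.stub_globalize →
      __Registered.stub_extend → Theses.WeightedInvariant.GlobalizeLocalDrop := by
  intro h3 hclimb hglob hext
  unfold Theses.WeightedInvariant.GlobalizeLocalDrop
  intro _
  exact hext (hglob (transversalRung_all h3 hclimb))

/-- The crux from the four stubs (sorried through the stubs only). [folklore] -/
theorem GlobalizeLocalDrop_proof : Theses.WeightedInvariant.GlobalizeLocalDrop :=
  GlobalizeLocalDrop_of stub_rungThree stub_climb stub_globalize stub_extend

end Summit.ResolutionOfSingularities.ResolutionOfSingularities.Cruxes.GlobalizeLocalDrop.TransversalDimensionLadder
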